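import Mathlib
import HarnessLib
import Literature.NumberTheory.Transcendental.KZCalculus
import Literature.NumberTheory.Transcendental.KZSemiCanonicalReductionProofs

/-!
# Stub `stub_compactifyZero` of line `janus-bands` (crux `ArrangementNormalForm`, skeleton v5)

A crux input `[cell, p / ∏ Lⱼ^{eⱼ}]` (open rational polyhedral cell, maybe unbounded) is congruent
modulo `KZ.relations` to a `ℤ`-combination of Janus band representations of base dimension `n`
with EXACTLY `0` fibres (class `JJ n 0`) on BOUNDED cells: cut the cell by the (null) coordinate
hyperplanes into its traces on the `2ⁿ` open orthants (rule (1a)), and on the orthant of sign `c`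
change variables by the projective map `x ↦ x / (1 + c⬝x)` (rule (2)): `ℚ`-semialgebraic,
injective (inverse `y ↦ y / (1 − c⬝y)`), Jacobian `(1 + c⬝x)^{−(n+1)}` (matrix determinant
lemma), bounded image (again an open rational polyhedral cell), new integrand of the same shape
(homogenise `p` by powers of `1 − c⬝y`, tilt the affine forms, one extra denominator `1 − c⬝y`).
Mechanical adaptation of the landed `stub_compactify` (fibre number pinned to `0`).
-/

noncomputable section

open Set MeasureTheory MvPolynomial Literature.NumberTheory.Transcendental
open Literature.ModelTheory.ExponentialFields

namespace Summit.KontsevichZagierPeriods.ArrangementNormalForm.JanusBands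

variable {n : ℕ}

/-- `c⬝(g • x) = g (c⬝x)`. -/
private theorem cz_dot_smul (c : Fin n → ℚ) (g : ℝ) (x : Fin n → ℝ) :
    (∑ k, (c k : ℝ) * (g • x) k) = g * (∑ k, (c k : ℝ) * x k) := by
  simp only [Pi.smul_apply, smul_eq_mul, Finset.mul_sum]
  exact Finset.sum_congr rfl fun i _ => by ring

/-- `c⬝eⱼ = cⱼ`. -/
private theorem cz_dot_single (c : Fin n → ℚ) (j : Fin n) : (∑ k, (c k : ℝ) * ((Pi.single j 1 : Fin n → ℝ)) k) = c j := by
  rw [Finset.sum_eq_single j (fun i _ hi => by rw [Pi.single_eq_of_ne hi, mul_zero])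
    (fun h => absurd (Finset.mem_univ j) h), Pi.single_eq_same, mul_one]

/-- **Derivative and Jacobian of the projective map** `x ↦ x / (1 + c⬝x)`: off `1 + c⬝x = 0` the
derivative is `g·id − g²·(x ⊗ c)`, `g = (1 + c⬝x)⁻¹`, of determinant `g^{n+1}` (matrix det lemma). -/
private theorem cz_exists_fderiv_proj (c : Fin n → ℚ) (x : Fin n → ℝ) :
    ∃ Φ' : (Fin n → ℝ) →L[ℝ] (Fin n → ℝ), 1 + (∑ k, (c k : ℝ) * x k) ≠ 0 →
      HasFDerivAt (fun y : Fin n → ℝ => (1 + (∑ k, (c k : ℝ) * y k))⁻¹ • y) Φ' x ∧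
        Φ'.det = ((1 + (∑ k, (c k : ℝ) * x k))⁻¹) ^ (n + 1) := by
  by_cases hx : 1 + (∑ k, (c k : ℝ) * x k) = 0
  · exact ⟨0, fun h => absurd hx h⟩
  set S : (Fin n → ℝ) →L[ℝ] ℝ := ∑ i, (c i : ℝ) • ContinuousLinearMap.proj i with hS
  have hSv : ∀ v, S v = (∑ k, (c k : ℝ) * v k) := fun v => by simp [hS]
  obtain ⟨g, hg⟩ : ∃ g, (1 + (∑ k, (c k : ℝ) * x k))⁻¹ = g := ⟨_, rfl⟩
  refine ⟨g • ContinuousLinearMap.id ℝ (Fin n → ℝ) - (g ^ 2) • S.smulRight x, fun _ => ⟨?_, ?_⟩⟩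
  · have h1 : HasFDerivAt (fun y => 1 + S y) S x := S.hasFDerivAt.const_add 1
    have hx' : 1 + S x ≠ 0 := by rwa [hSv]
    have h2 := (((hasFDerivAt_inv hx').comp x h1).smul (hasFDerivAt_id x)).congr_of_eventuallyEq
      (f₁ := fun y : Fin n → ℝ => (1 + (∑ k, (c k : ℝ) * y k))⁻¹ • y)
      (Filter.Eventually.of_forall fun y => by simp [hSv])
    have hgS : (1 + S x)⁻¹ = g := by rw [hSv, hg]
    have hsqS : ((1 + S x) ^ 2)⁻¹ = g ^ 2 := by rw [← hgS, inv_pow]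
    refine h2.congr_fderiv ?_
    ext v i
    simp [hgS, hsqS]
    ring
  · have hmat : LinearMap.toMatrix'
        ((g • ContinuousLinearMap.id ℝ (Fin n → ℝ) - (g ^ 2) • S.smulRight x :
          (Fin n → ℝ) →L[ℝ] (Fin n → ℝ)) : (Fin n → ℝ) →ₗ[ℝ] (Fin n → ℝ)) =
        g • ((1 : Matrix (Fin n) (Fin n) ℝ) +
          Matrix.vecMulVec (fun i => -(g * x i)) fun j => (c j : ℝ)) := by
      ext i j
      rw [LinearMap.toMatrix'_apply, ContinuousLinearMap.coe_coe]
      simp [hSv, Pi.single_apply, Matrix.one_apply, Matrix.vecMulVec_apply]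
      split_ifs <;> ring
    rw [hg, ContinuousLinearMap.det, ← LinearMap.det_toMatrix', hmat, Matrix.det_smul,
      Fintype.card_fin, Matrix.vecMulVec_eq (Fin 1),
      Matrix.det_one_add_replicateCol_mul_replicateRow, pow_succ]
    congr 1
    have h1 : g * (1 + (∑ k, (c k : ℝ) * x k)) = 1 := by rw [← hg]; exact inv_mul_cancel₀ hx
    rw [mul_add, mul_one, Finset.mul_sum] at h1
    have : (fun j => (c j : ℝ)) ⬝ᵥ (fun i => -(g * x i)) = -∑ i, g * ((c i : ℝ) * x i) := by
      simp only [dotProduct, mul_neg, Finset.sum_neg_distrib]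
      exact congrArg _ (Finset.sum_congr rfl fun i _ => by ring)
    rw [this]; linarith

/-- Evaluation of the affine polynomial. -/
private theorem cz_aeval_aff (a : Fin n → ℚ) (b : ℚ) (x : Fin n → ℝ) :
    aeval x (∑ k, C (a k) * X k + C b : MvPolynomial (Fin n) ℚ) = (∑ k, (a k : ℝ) * x k + (b : ℝ)) := by
  simp [map_sum]

/-- Open rational polyhedral cells are `ℚ`-semialgebraic. -/
private theorem cz_isSemialgebraic_cell {ι : Type*} [Fintype ι] (M : ι → (Fin n → ℚ) × ℚ) :
    IsSemialgebraic ℚ {x : Fin n → ℝ | ∀ j, 0 < (∑ k, ((M j).1 k : ℝ) * x k + ((M j).2 : ℝ))} := by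
  have : {x : Fin n → ℝ | ∀ j, 0 < (∑ k, ((M j).1 k : ℝ) * x k + ((M j).2 : ℝ))} =
      ⋂ j ∈ (Finset.univ : Finset ι), {x | 0 < aeval x (∑ k, C ((M j).1 k) * X k + C (M j).2 : MvPolynomial (Fin n) ℚ)} := by
    ext x
    simp only [mem_setOf_eq, mem_iInter, Finset.mem_univ, true_implies, cz_aeval_aff]
  rw [this]; exact IsSemialgebraic.biInter _ _ fun j _ => isSemialgebraic_setOf_eval_pos _

/-- The affine form `1 - c⬝y`. -/
private theorem cz_aff_neg_one (c : Fin n → ℚ) (y : Fin n → ℝ) :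
    (∑ k, ((-c) k : ℝ) * y k + ((1 : ℚ) : ℝ)) = 1 - (∑ k, (c k : ℝ) * y k) := by
  simp only [Pi.neg_apply, Rat.cast_neg, neg_mul, Finset.sum_neg_distrib, Rat.cast_one]
  ring

/-- The affine form `1 + c⬝x`. -/
private theorem cz_aff_one (c : Fin n → ℚ) (x : Fin n → ℝ) :
    (∑ k, (c k : ℝ) * x k + ((1 : ℚ) : ℝ)) = 1 + (∑ k, (c k : ℝ) * x k) := by
  rw [Rat.cast_one, add_comm]

/-- The tilted form `(a - b c, b)` at `g • x`, `g = (1 + c⬝x)⁻¹`, is `g` times `(a, b)` at `x`. -/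
private theorem cz_aff_tilt_smul (c a : Fin n → ℚ) (b : ℚ) {x : Fin n → ℝ} {g : ℝ}
    (hg : g * (1 + (∑ k, (c k : ℝ) * x k)) = 1) :
    (∑ k, ((a - b • c) k : ℝ) * (g • x) k + (b : ℝ)) = g * (∑ k, (a k : ℝ) * x k + (b : ℝ)) := by
  simp only [Pi.sub_apply, Pi.smul_apply, smul_eq_mul, Rat.cast_sub, Rat.cast_mul]
  have : ∑ i, ((a i : ℝ) - b * c i) * (g * x i) =
      g * ∑ i, (a i : ℝ) * x i - (b : ℝ) * (g * ∑ i, (c i : ℝ) * x i) := by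
    simp only [Finset.mul_sum, ← Finset.sum_sub_distrib]
    exact Finset.sum_congr rfl fun i _ => by ring
  rw [this]
  linear_combination (-(b : ℝ)) * hg

/-- `1 - c⬝(g • x) = g` for `g = (1 + c⬝x)⁻¹`. -/
private theorem cz_one_sub_dot_smul {c : Fin n → ℚ} {x : Fin n → ℝ} {g : ℝ} (hg : g * (1 + (∑ k, (c k : ℝ) * x k)) = 1) :
    1 - (∑ k, (c k : ℝ) * (g • x) k) = g := by
  rw [cz_dot_smul]
  linear_combination (-1 : ℝ) * hg

/-- **Homogenisation**: `q (g • x) = g ^ d · p x` whenever `g = (1 + c⬝x)⁻¹`, for some `d, q`. -/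
private theorem cz_exists_homog (c : Fin n → ℚ) (p : MvPolynomial (Fin n) ℚ) :
    ∃ (d : ℕ) (q : MvPolynomial (Fin n) ℚ), ∀ (x : Fin n → ℝ) (g : ℝ), g * (1 + (∑ k, (c k : ℝ) * x k)) = 1 →
      aeval (g • x) q = g ^ d * aeval x p := by
  have hT : ∀ (x : Fin n → ℝ) (g : ℝ), g * (1 + (∑ k, (c k : ℝ) * x k)) = 1 →
      aeval (g • x) (∑ k, C ((-c) k) * X k + C 1 : MvPolynomial (Fin n) ℚ) = g :=
    fun x g hg => by rw [cz_aeval_aff, cz_aff_neg_one, cz_one_sub_dot_smul hg]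
  induction p using MvPolynomial.induction_on with
  | C a => exact ⟨0, C a, fun x g _ => by simp⟩
  | add p q hp hq =>
    obtain ⟨d₁, q₁, h₁⟩ := hp
    obtain ⟨d₂, q₂, h₂⟩ := hq
    refine ⟨d₁ + d₂, q₁ * (∑ k, C ((-c) k) * X k + C 1 : MvPolynomial (Fin n) ℚ) ^ d₂ +
      q₂ * (∑ k, C ((-c) k) * X k + C 1 : MvPolynomial (Fin n) ℚ) ^ d₁, fun x g hg => ?_⟩
    rw [map_add, map_mul, map_mul, map_pow, map_pow, h₁ x g hg, h₂ x g hg, hT x g hg, map_add]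
    ring
  | mul_X p i hp =>
    obtain ⟨d, q, h⟩ := hp
    refine ⟨d + 1, q * X i, fun x g hg => ?_⟩
    rw [map_mul, aeval_X, h x g hg, map_mul, aeval_X, Pi.smul_apply, smul_eq_mul]
    ring

/-- `x ↦ p x / q x` (with `a / 0 = 0`) is `ℚ`-semialgebraic: graph `{q ≠ 0, zq = p} ∪ {q = 0 = z}`. -/
private theorem cz_isSemialgebraicFunOn_aeval_div {m : ℕ} {s : Set (Fin m → ℝ)} (hs : IsSemialgebraic ℚ s)
    (p q : MvPolynomial (Fin m) ℚ) :
    IsSemialgebraicFunOn ℚ s (fun x => aeval x p / aeval x q) := by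
  rw [isSemialgebraicFunOn_iff]
  have hinit : ∀ z : Fin (m + 1) → ℝ, (fun i => z (Fin.castSucc i)) = Fin.init z := fun _ => rfl
  convert hs.setOf_init_mem.inter
    ((((isSemialgebraic_setOf_eval_ne_zero (k := ℚ) (R := ℝ) (rename Fin.castSucc q)).inter
      (isSemialgebraic_setOf_eval_eq_zero
        (X (Fin.last m) * rename Fin.castSucc q - rename Fin.castSucc p))).union
      ((isSemialgebraic_setOf_eval_eq_zero (k := ℚ) (R := ℝ) (rename Fin.castSucc q)).inter
        (isSemialgebraic_setOf_eval_eq_zero (X (Fin.last m)))))) using 1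
  ext z
  simp only [mem_setOf_eq, mem_inter_iff, mem_union, map_sub, map_mul, aeval_X,
    aeval_rename, Function.comp_def, hinit, sub_eq_zero]
  refine and_congr_right fun _ => ?_
  by_cases hq : aeval (Fin.init z) q = 0
  · simp [hq]
  · simp [hq, eq_div_iff hq]

/-- On an orthant of sign `c`, `c⬝x ≥ 0`. -/
private theorem cz_dot_nonneg {c : Fin n → ℚ} {x : Fin n → ℝ} (hx : ∀ i, 0 < (c i : ℝ) * x i) :
    0 ≤ (∑ k, (c k : ℝ) * x k) :=
  Finset.sum_nonneg fun i _ => (hx i).le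

/-- The left inverse `y ↦ y / (1 − c⬝y)` of the projective map. -/
private theorem cz_smul_proj {c : Fin n → ℚ} {x : Fin n → ℝ} (hx : 0 < 1 + (∑ k, (c k : ℝ) * x k)) :
    (1 - (∑ k, (c k : ℝ) * ((1 + (∑ k, (c k : ℝ) * x k))⁻¹ • x) k))⁻¹ •
      ((1 + (∑ k, (c k : ℝ) * x k))⁻¹ • x) = x := by
  rw [cz_one_sub_dot_smul (inv_mul_cancel₀ hx.ne'), smul_smul, inv_inv,
    mul_inv_cancel₀ hx.ne', one_smul]

/-- The projective map is injective where `1 + c⬝x > 0`. -/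
private theorem cz_injOn_proj (c : Fin n → ℚ) {D : Set (Fin n → ℝ)} (hD : ∀ x ∈ D, 0 < 1 + (∑ k, (c k : ℝ) * x k)) :
    InjOn (fun x : Fin n → ℝ => (1 + (∑ k, (c k : ℝ) * x k))⁻¹ • x) D := fun x hx x' hx' h => by
  have h' : (1 + (∑ k, (c k : ℝ) * x k))⁻¹ • x = (1 + (∑ k, (c k : ℝ) * x' k))⁻¹ • x' := h
  rw [← cz_smul_proj (hD x hx), ← cz_smul_proj (hD x' hx'), h']

/-- **Image of a cell under the projective map**: cut out by `1 − c⬝y > 0` and tilted forms. -/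
private theorem cz_image_proj (c : Fin n → ℚ) {ι : Type*} (M : ι → (Fin n → ℚ) × ℚ)
    (hD : ∀ x ∈ {x : Fin n → ℝ | ∀ j, 0 < (∑ k, ((M j).1 k : ℝ) * x k + ((M j).2 : ℝ))},
      0 < 1 + (∑ k, (c k : ℝ) * x k)) :
    (fun x : Fin n → ℝ => (1 + (∑ k, (c k : ℝ) * x k))⁻¹ • x) ''
        {x | ∀ j, 0 < (∑ k, ((M j).1 k : ℝ) * x k + ((M j).2 : ℝ))} =
      {y | 0 < (∑ k, ((-c) k : ℝ) * y k + ((1 : ℚ) : ℝ)) ∧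
        ∀ j, 0 < (∑ k, (((M j).1 - (M j).2 • c) k : ℝ) * y k + ((M j).2 : ℝ))} := by
  ext y
  simp only [mem_image, mem_setOf_eq]
  constructor
  · rintro ⟨x, hx, rfl⟩
    have hg := inv_mul_cancel₀ (hD x hx).ne'
    have hgpos : 0 < (1 + (∑ k, (c k : ℝ) * x k))⁻¹ := inv_pos.mpr (hD x hx)
    refine ⟨by rw [cz_aff_neg_one, cz_one_sub_dot_smul hg]; exact hgpos, fun j => ?_⟩
    rw [cz_aff_tilt_smul c _ _ hg]
    exact mul_pos hgpos (hx j)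
  · rintro ⟨hy, hM⟩
    rw [cz_aff_neg_one] at hy
    have hy0 : 1 - (∑ k, (c k : ℝ) * y k) ≠ 0 := hy.ne'
    have ht : (1 - (∑ k, (c k : ℝ) * y k)) * (1 + (∑ k, (c k : ℝ) * ((1 - (∑ k, (c k : ℝ) * y k))⁻¹ • y) k)) = 1 := by
      rw [cz_dot_smul, mul_add, mul_one, ← mul_assoc, mul_inv_cancel₀ hy0, one_mul]
      ring
    have hx : ∀ j, 0 < (∑ k, ((M j).1 k : ℝ) * ((1 - (∑ k, (c k : ℝ) * y k))⁻¹ • y) k + ((M j).2 : ℝ)) := fun j => by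
      have h := cz_aff_tilt_smul c (M j).1 (M j).2 ht
      rw [smul_smul, mul_inv_cancel₀ hy0, one_smul] at h
      nlinarith [hM j, h, inv_pos.mpr hy]
    refine ⟨(1 - (∑ k, (c k : ℝ) * y k))⁻¹ • y, hx, ?_⟩
    rw [smul_smul]
    have : (1 + (∑ k, (c k : ℝ) * ((1 - (∑ k, (c k : ℝ) * y k))⁻¹ • y) k))⁻¹ = 1 - (∑ k, (c k : ℝ) * y k) := by
      rw [← mul_eq_one_iff_inv_eq₀ (hD _ hx).ne']
      linear_combination ht
    rw [this, mul_inv_cancel₀ hy0, one_smul]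

/-- **The image of an orthant piece is bounded** (coordinates of absolute value `≤ 1`). -/
private theorem cz_isBounded_image_proj (c : Fin n → ℚ) (hc : ∀ i, c i = 1 ∨ c i = -1)
    {D : Set (Fin n → ℝ)} (hD : ∀ x ∈ D, ∀ i, 0 < (c i : ℝ) * x i) :
    Bornology.IsBounded ((fun x : Fin n → ℝ => (1 + (∑ k, (c k : ℝ) * x k))⁻¹ • x) '' D) := by
  refine isBounded_iff_forall_norm_le.mpr ⟨1, ?_⟩
  rintro _ ⟨x, hx, rfl⟩
  show ‖(1 + (∑ k, (c k : ℝ) * x k))⁻¹ • x‖ ≤ 1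
  rw [pi_norm_le_iff_of_nonneg zero_le_one]
  intro i
  have hs := cz_dot_nonneg (hD x hx)
  have hpos : 0 < 1 + (∑ k, (c k : ℝ) * x k) := by linarith
  have hle : (c i : ℝ) * x i ≤ (∑ k, (c k : ℝ) * x k) :=
    Finset.single_le_sum (fun j _ => (hD x hx j).le) (Finset.mem_univ i)
  have hc1 : |(c i : ℝ)| = 1 := by rcases hc i with h | h <;> simp [h]
  have habs : |x i| = (c i : ℝ) * x i := by
    rw [← one_mul |x i|, ← hc1, ← abs_mul, abs_of_pos (hD x hx i)]
  rw [Pi.smul_apply, smul_eq_mul, Real.norm_eq_abs, abs_mul, abs_of_pos (inv_pos.mpr hpos), habs,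
    inv_mul_le_iff₀ hpos]
  linarith

/-- The projective map is `ℚ`-semialgebraic where `1 + c⬝x > 0` (coordinates `Xᵢ / (1 + c⬝X)`). -/
private theorem cz_isSemialgebraicMapOn_proj (c : Fin n → ℚ) {D : Set (Fin n → ℝ)} (hDs : IsSemialgebraic ℚ D)
    (hD : ∀ x ∈ D, 0 < 1 + (∑ k, (c k : ℝ) * x k)) :
    IsSemialgebraicMapOn ℚ D (fun x : Fin n → ℝ => (1 + (∑ k, (c k : ℝ) * x k))⁻¹ • x) :=
  IsSemialgebraicMapOn.of_forall hDs fun i =>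
    (isSemialgebraicFunOn_aeval_div_aeval hDs (X i) (∑ k, C (c k) * X k + C 1 : MvPolynomial (Fin n) ℚ)
      fun x hx => by rw [cz_aeval_aff, cz_aff_one]; exact (hD x hx).ne').congr fun x hx => by
      show aeval x (X i) / aeval x (∑ k, C (c k) * X k + C 1 : MvPolynomial (Fin n) ℚ) = ((1 + (∑ k, (c k : ℝ) * x k))⁻¹ • x) i
      rw [aeval_X, cz_aeval_aff, cz_aff_one, Pi.smul_apply, smul_eq_mul, div_eq_inv_mul]

/-- **Compactification of one orthant piece** `[cell M ⊆ orthant c, p / ∏ Lⱼ^{eⱼ}]` by one change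
of variables along the projective map: a representation on a BOUNDED cell, same shape. -/
private theorem cz_compactify_piece {m m' : ℕ} (c : Fin n → ℚ) (hc : ∀ i, c i = 1 ∨ c i = -1)
    (r : KZ.IntegralRep n) (M : Fin m' → (Fin n → ℚ) × ℚ) (L : Fin m → (Fin n → ℚ) × ℚ)
    (e : Fin m → ℕ) (p : MvPolynomial (Fin n) ℚ)
    (hdom : r.domain = {x | ∀ j, 0 < (∑ k, ((M j).1 k : ℝ) * x k + ((M j).2 : ℝ))})
    (hpos : ∀ x ∈ r.domain, ∀ i, 0 < (c i : ℝ) * x i)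
    (hint : EqOn r.integrand (fun x => aeval x p / ∏ j, (∑ k, ((L j).1 k : ℝ) * x k + ((L j).2 : ℝ)) ^ e j) r.domain) :
    ∃ (s : KZ.IntegralRep n) (M' : Fin (m' + 1) → (Fin n → ℚ) × ℚ)
      (L' : Fin (m + 1) → (Fin n → ℚ) × ℚ) (e' : Fin (m + 1) → ℕ) (p' : MvPolynomial (Fin n) ℚ),
      Bornology.IsBounded s.domain ∧ s.domain = {y | ∀ j, 0 < (∑ k, ((M' j).1 k : ℝ) * y k + ((M' j).2 : ℝ))} ∧
      EqOn s.integrand (fun y => aeval y p' / ∏ j, (∑ k, ((L' j).1 k : ℝ) * y k + ((L' j).2 : ℝ)) ^ e' j) s.domain ∧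
      KZ.of r - KZ.of s ∈ KZ.relations := by
  obtain ⟨d, q, hq⟩ := cz_exists_homog c p
  choose Φ' hΦ' using cz_exists_fderiv_proj (n := n) c
  have h1 : ∀ x ∈ r.domain, 0 < 1 + (∑ k, (c k : ℝ) * x k) := fun x hx => by
    have := cz_dot_nonneg (hpos x hx); linarith
  set E := ∑ j, e j with hE
  set N := d + (n + 1)
  set M' : Fin (m' + 1) → (Fin n → ℚ) × ℚ :=
    Fin.cons (-c, 1) fun j => ((M j).1 - (M j).2 • c, (M j).2) with hM'
  set L' : Fin (m + 1) → (Fin n → ℚ) × ℚ :=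
    Fin.cons (-c, 1) fun j => ((L j).1 - (L j).2 • c, (L j).2) with hL'
  set e' : Fin (m + 1) → ℕ := Fin.cons (N - E) e with he'
  set p' : MvPolynomial (Fin n) ℚ := q * (∑ k, C ((-c) k) * X k + C 1 : MvPolynomial (Fin n) ℚ) ^ (E - N) with hp'
  set F : (Fin n → ℝ) → ℝ := fun y => aeval y p' / ∏ j, (∑ k, ((L' j).1 k : ℝ) * y k + ((L' j).2 : ℝ)) ^ e' j with hF
  have key : ∀ x ∈ r.domain,
      r.integrand x = F ((1 + (∑ k, (c k : ℝ) * x k))⁻¹ • x) * ((1 + (∑ k, (c k : ℝ) * x k))⁻¹) ^ (n + 1) := by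
    intro x hx
    obtain ⟨g, hgdef⟩ : ∃ g, (1 + (∑ k, (c k : ℝ) * x k))⁻¹ = g := ⟨_, rfl⟩
    have hg : g * (1 + (∑ k, (c k : ℝ) * x k)) = 1 := by rw [← hgdef]; exact inv_mul_cancel₀ (h1 x hx).ne'
    have hg0 : g ≠ 0 := by rw [← hgdef]; exact (inv_pos.mpr (h1 x hx)).ne'
    have hN : d + (E - N) + (n + 1) = (N - E) + E := by omega
    rw [hint hx, hF]
    simp only [hL', he', hp', Fin.prod_univ_succ, Fin.cons_zero, Fin.cons_succ, map_mul, map_pow,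
      cz_aeval_aff, hgdef]
    rw [hq x _ hg, cz_aff_neg_one, cz_one_sub_dot_smul hg]
    simp only [cz_aff_tilt_smul c _ _ hg, mul_pow, Finset.prod_mul_distrib, Finset.prod_pow_eq_pow_sum]
    rw [div_mul_eq_mul_div, ← hE,
      show g ^ d * aeval x p * g ^ (E - N) * g ^ (n + 1) = g ^ ((N - E) + E) * aeval x p by
        rw [← hN]; ring,
      show g ^ (N - E) * (g ^ E * ∏ j, (∑ k, ((L j).1 k : ℝ) * x k + ((L j).2 : ℝ)) ^ e j) =
        g ^ ((N - E) + E) * ∏ j, (∑ k, ((L j).1 k : ℝ) * x k + ((L j).2 : ℝ)) ^ e j by ring]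
    exact (mul_div_mul_left _ _ (pow_ne_zero _ hg0)).symm
  have hmeas : MeasurableSet r.domain := KZ.IntegralRep.measurableSet_domain_holds r
  have hderiv : ∀ x ∈ r.domain, HasFDerivWithinAt (fun y : Fin n → ℝ => (1 + (∑ k, (c k : ℝ) * y k))⁻¹ • y)
      (Φ' x) r.domain x := fun x hx => (hΦ' x (h1 x hx).ne').1.hasFDerivWithinAt
  have hinj := cz_injOn_proj c h1
  have hdet : ∀ x ∈ r.domain, |(Φ' x).det| = ((1 + (∑ k, (c k : ℝ) * x k))⁻¹) ^ (n + 1) := fun x hx => by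
    rw [(hΦ' x (h1 x hx).ne').2, abs_of_pos (pow_pos (inv_pos.mpr (h1 x hx)) _)]
  have himg : (fun x : Fin n → ℝ => (1 + (∑ k, (c k : ℝ) * x k))⁻¹ • x) '' r.domain =
      {y | ∀ j, 0 < (∑ k, ((M' j).1 k : ℝ) * y k + ((M' j).2 : ℝ))} := by
    rw [hdom, cz_image_proj c M (hdom ▸ h1)]
    ext y
    simp only [mem_setOf_eq, hM', Fin.forall_fin_succ, Fin.cons_zero, Fin.cons_succ]
  have hSd : IsSemialgebraic ℚ {y : Fin n → ℝ | ∀ j, 0 < (∑ k, ((M' j).1 k : ℝ) * y k + ((M' j).2 : ℝ))} :=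
    cz_isSemialgebraic_cell M'
  have hSf : IsSemialgebraicFunOn ℚ {y : Fin n → ℝ | ∀ j, 0 < (∑ k, ((M' j).1 k : ℝ) * y k + ((M' j).2 : ℝ))} F :=
    (cz_isSemialgebraicFunOn_aeval_div hSd p' (∏ j, (∑ k, C ((L' j).1 k) * X k + C (L' j).2 : MvPolynomial (Fin n) ℚ) ^ e' j)).congr
      fun y _ => by simp only [hF, map_prod, map_pow, cz_aeval_aff]
  have hFi : IntegrableOn F {y | ∀ j, 0 < (∑ k, ((M' j).1 k : ℝ) * y k + ((M' j).2 : ℝ))} := by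
    rw [← himg, integrableOn_image_iff_integrableOn_abs_det_fderiv_smul volume hmeas hderiv hinj]
    refine r.integrableOn.congr_fun (fun x hx => ?_) hmeas
    rw [smul_eq_mul, hdet x hx, key x hx, mul_comm]
  set s : KZ.IntegralRep n := ⟨_, F, hSd, hSf, hFi⟩
  refine ⟨s, M', L', e', p', ?_, rfl, fun y _ => rfl, ?_⟩
  · show Bornology.IsBounded {y : Fin n → ℝ | ∀ j, 0 < (∑ k, ((M' j).1 k : ℝ) * y k + ((M' j).2 : ℝ))}
    rw [← himg]
    exact cz_isBounded_image_proj c hc hpos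
  · exact KZ.changeOfVariablesRel_subset_relations ⟨n, r, s, _, Φ',
      cz_isSemialgebraicMapOn_proj c r.isSemialgebraic_domain h1, hderiv, hinj, himg.symm,
      fun x hx => by rw [hdet x hx]; exact key x hx, rfl⟩

/-- Signs `±1`. -/
private theorem cz_sgn_cases (ε : Fin n → Bool) (i : Fin n) :
    (if ε i then (1 : ℚ) else -1) = 1 ∨ (if ε i then (1 : ℚ) else -1) = -1 := by
  split_ifs <;> simp

/-- Two open orthants meeting at a point coincide. -/
private theorem cz_sgn_eq_of_pos {ε ε' : Fin n → Bool} {x : Fin n → ℝ} {i : Fin n}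
    (h : 0 < ((if ε i then (1 : ℚ) else -1 : ℚ) : ℝ) * x i)
    (h' : 0 < ((if ε' i then (1 : ℚ) else -1 : ℚ) : ℝ) * x i) : ε i = ε' i := by
  cases hε : ε i <;> cases hε' : ε' i <;> simp [hε, hε'] at h h' ⊢ <;> linarith

/-- A point off the coordinate hyperplanes lies in the open orthant of its sign vector. -/
private theorem cz_sgn_decide_mul_pos {x : Fin n → ℝ} {i : Fin n} (hx : x i ≠ 0) :
    0 < ((if decide (0 < x i) then (1 : ℚ) else -1 : ℚ) : ℝ) * x i := by
  by_cases h : 0 < x i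
  · simp [h]
  · have : x i < 0 := lt_of_le_of_ne (not_lt.mp h) hx
    simp [h]; linarith

/-- Evaluation of a coordinate row `(s eᵢ, 0)`. -/
private theorem cz_aff_single (i : Fin n) (s : ℚ) (x : Fin n → ℝ) :
    (∑ k, (((Pi.single i s : Fin n → ℚ)) k : ℝ) * x k + ((0 : ℚ) : ℝ)) = (s : ℝ) * x i := by
  rw [Rat.cast_zero, add_zero, Finset.sum_eq_single i
    (fun j _ hj => by rw [Pi.single_eq_of_ne hj, Rat.cast_zero, zero_mul])
    (fun h => absurd (Finset.mem_univ i) h), Pi.single_eq_same]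

/-- Quantifying over `Fin (a + b)` blockwise. -/
private theorem cz_forall_fin_add {a b : ℕ} (P : Fin (a + b) → Prop) :
    (∀ j, P j) ↔ (∀ i, P (Fin.castAdd b i)) ∧ ∀ i, P (Fin.natAdd a i) :=
  ⟨fun h => ⟨fun _ => h _, fun _ => h _⟩, fun h j => Fin.addCases (motive := P) h.1 h.2 j⟩

/-- **stub_compactifyZero.** Every crux input `[cell, p/∏Lⱼ^{eⱼ}]` (cell possibly unbounded) is
congruent modulo `KZ.relations` to a `ℤ`-combination of elements of `JJ n 0` (bounded cells, no
fibres), by orthant dissection (rule (1a)) and `cz_compactify_piece` (rule (2)) on each piece. -/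
theorem stub_compactifyZero (JJ : ℕ → ℕ → Set KZ.FormalRep) (hJJ : ∀ b k, JJ b k = {w : KZ.FormalRep | ∃ (m m' : ℕ) (s : KZ.IntegralRep (b + k)) (M : Fin m' → (Fin b → ℚ) × ℚ) (L : Fin m → (Fin b → ℚ) × ℚ) (e : Fin m → ℕ) (p : MvPolynomial (Fin b) ℚ) (a : Fin k → Option ((Fin b → ℚ) × ℚ)) (lo hi : Fin k → Fin k ⊕ ((Fin b → ℚ) × ℚ)), Bornology.IsBounded s.domain ∧ s.domain = {z | (∀ j, 0 < ∑ i, ((M j).1 i : ℝ) * z (Fin.castAdd k i) + ((M j).2 : ℝ)) ∧ ∀ i, Sum.elim (fun j => z (Fin.natAdd b j)) (fun c => ∑ i', (c.1 i' : ℝ) * z (Fin.castAdd k i') + (c.2 : ℝ)) (lo i) < z (Fin.natAdd b i) ∧ z (Fin.natAdd b i) < Sum.elim (fun j => z (Fin.natAdd b j)) (fun c => ∑ i', (c.1 i' : ℝ) * z (Fin.castAdd k i') + (c.2 : ℝ)) (hi i)} ∧ EqOn s.integrand (fun z => MvPolynomial.aeval (fun i => z (Fin.castAdd k i)) p / (∏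 j, (∑ i, ((L j).1 i : ℝ) * z (Fin.castAdd k i) + ((L j).2 : ℝ)) ^ e j) * ∏ i, (a i).elim 1 (fun c => 1 / (z (Fin.natAdd b i) - (∑ i', (c.1 i' : ℝ) * z (Fin.castAdd k i') + (c.2 : ℝ))))) s.domain ∧ w = KZ.of s}) (n m m' : ℕ) (r : KZ.IntegralRep n) (M : Fin m' → (Fin n → ℚ) × ℚ) (L : Fin m → (Fin n → ℚ) × ℚ) (e : Fin m → ℕ) (p : MvPolynomial (Fin n) ℚ) (hdom : r.domain = {x | ∀ j, 0 < ∑ i, ((M j).1 i : ℝ) * x i + ((M j).2 : ℝ)}) (hint : EqOn r.integrand (fun x => MvPolynomial.aeval x p / ∏ j, (∑ i, ((L j).1 i : ℝ) * x i + ((L j).2 : ℝ)) ^ e j) r.domain) : ∃ c ∈ AddSubgroup.closure (JJ n 0), KZ.of r - c ∈ KZ.relations := by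
  classical
  set D : (Fin n → Bool) → Set (Fin n → ℝ) := fun ε => {x : Fin n → ℝ | ∀ j, 0 <
      (∑ k, (((Fin.append M (fun i => (Pi.single i (if ε i then (1 : ℚ) else -1), (0 : ℚ))) j).1) k : ℝ) *
        x k + ((Fin.append M (fun i => (Pi.single i (if ε i then (1 : ℚ) else -1), (0 : ℚ))) j).2 : ℝ))}
  have hDs : ∀ ε : Fin n → Bool, IsSemialgebraic ℚ (D ε) := fun ε => cz_isSemialgebraic_cell _
  have hD : ∀ ε : Fin n → Bool,
      D ε = r.domain ∩ {x | ∀ i, 0 < ((if ε i then (1 : ℚ) else -1 : ℚ) : ℝ) * x i} := fun ε => by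
    ext x
    simp only [D, mem_setOf_eq, mem_inter_iff, cz_forall_fin_add, Fin.append_left, Fin.append_right,
      cz_aff_single, hdom]
  have hsub : ∀ ε : Fin n → Bool, D ε ⊆ r.domain := fun ε => (hD ε).trans_subset inter_subset_left
  set R : (Fin n → Bool) → KZ.IntegralRep n := fun ε => r.restrict _ (hDs ε) (hsub ε)
  have e1 : KZ.of r - ∑ ε, KZ.of (R ε) ∈ KZ.relations := by
    refine KZ.of_sub_sum_of_mem_relations Finset.univ r R (fun ε _ => ?_) (fun ε _ _ _ => rfl) ?_ ?_
    · rw [show (R ε).domain \ r.domain = ∅ from sdiff_eq_empty.mpr (hsub ε), measure_empty]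
    · refine measure_mono_null (fun x hx => ?_) (measure_iUnion_null_iff.mpr fun i : Fin n =>
        show volume {x : Fin n → ℝ | x i = 0} = 0 by
          rw [volume_pi]; exact Measure.pi_hyperplane (fun _ => volume) i 0)
      by_contra h
      simp only [mem_iUnion, mem_setOf_eq, not_exists] at h
      exact hx.2 (mem_biUnion (Finset.mem_univ (fun j => decide (0 < x j)))
        ((hD _).symm.subset ⟨hx.1, fun i => cz_sgn_decide_mul_pos (h i)⟩))
    · intro ε _ ε' _ hne
      rw [show (R ε).domain ∩ (R ε').domain = ∅ from ?_, measure_empty]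
      exact eq_empty_of_forall_notMem fun x hx => hne (funext fun i =>
        cz_sgn_eq_of_pos (((hD ε).subset hx.1).2 i) (((hD ε').subset hx.2).2 i))
  choose S M' L' e' p' hb hd hi hrel using fun ε : Fin n → Bool =>
    cz_compactify_piece (fun i => if ε i then (1 : ℚ) else -1) (cz_sgn_cases ε) (R ε)
      (Fin.append M fun i => (Pi.single i (if ε i then (1 : ℚ) else -1), (0 : ℚ))) L e p rfl
      (fun x hx => ((hD ε).subset hx).2) (hint.mono (hsub ε))
  refine ⟨∑ ε, KZ.of (S ε), AddSubgroup.sum_mem _ fun ε _ => AddSubgroup.subset_closure ?_, ?_⟩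
  · rw [hJJ]
    refine ⟨m + 1, m' + n + 1, S ε, M' ε, L' ε, e' ε, p' ε, Fin.elim0, Fin.elim0, Fin.elim0,
      hb ε, ?_, ?_, rfl⟩
    · rw [hd ε]; ext z; simp
    · intro z hz; rw [hi ε hz]; simp
  · convert KZ.relations.add_mem e1
      (KZ.sum_sub_sum_mem_relations Finset.univ _ _ fun ε _ => hrel ε) using 1
    abel

end Summit.KontsevichZagierPeriods.ArrangementNormalForm.JanusBands
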